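import Summits.NavierStokesRegularity.NavierStokesRegularity.Theorems.OddMorawetzOrderThreeIndefiniteCalculus
import Summits.NavierStokesRegularity.NavierStokesRegularity.Theorems.OddMorawetzOrderThreeIndefiniteDuality

/-!
# Route OddMorawetz / `OrderThreeIndefinite` — the order-3 form of an explicit polynomial-Gaussian field

Support file for item stmt-NavierStokesRegularity-1379: for ANY polynomial data `P : Fin 3 → P3`, the field
`v = pgv 1 P = P e^{-|x|²}` is a Schwartz field, divergence free once `∑ᵢ dg 1 i (P i) = 0`, and its order-3
Euler-derivative form is reduced to two explicit pairings of the bookkeeping polynomials of `OddMorawetzDefs`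
(`orderThree_formula`):
`Q_R(v) = -½ [ ∫ (WGP P) e^{-4|x|²} dx − (4π²)⁻¹ Re ∫ 𝓕[(rhoWP P) e^{-2r²}] conj 𝓕[(rhoGP P) e^{-2r²}] / |ξ|² dξ ]`,
by matching the generic test fields `psiVec` with `pgv 2 (psiP P j)` (`pgv_psiP_eq`), `W = 2(v·∇)v` with
`pgv 2 (WP P)`, `G = ∑ⱼ∂ⱼΨⱼ` with `pgv 2 (GP P)`, and the complex divergences with `pgC 2 (rhoWP P)`, `pgC 2 (rhoGP P)`.
Everything is proved; no definitions.
-/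

noncomputable section

open MeasureTheory SchwartzMap MvPolynomial
open scoped RealInnerProductSpace LineDeriv

-- the problem namespace `Summit.NavierStokesRegularity.NavierStokesRegularity` repeats the summit name by design (D-0017)
set_option linter.dupNamespace false

namespace Summit.NavierStokesRegularity.NavierStokesRegularity.Theorems.OddMorawetz

/-! ### Generic explicit-field layer: polynomial bookkeeping of the order-3 computation -/

section Generic
open Literature.Analysis Literature.Analysis.FluidPDE
variable (P : Fin 3 → P3)

/-- A polynomial Gaussian field is divergence free once the polynomial identity `∑ᵢ dg 1 i (P i) = 0` holds. -/
theorem isDivFree_pgv (hdiv : ∑ i, dg 1 i (P i) = 0) : VectorCalculus.IsDivFree (pgv 1 P) := by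
  intro x
  rw [divergence_pgv, ← pg_sum, hdiv, pg_zero]

/-- components of `A w` for the explicit field -/
theorem fderiv_pgv_apply' (k : ℕ) (x w : E3) (i : Fin 3) :
    fderiv ℝ (pgv k P) x w i = ∑ j : Fin 3, w j * pg k (dg k j (P i)) x := fderiv_pgv_apply k P x w i

/-- **The test fields match**: `pgv 2 (psiP P j) x = psiVec (Dv x) (curl v x) j` for `v = pgv 1 P`. -/
theorem pgv_psiP_eq (j : Fin 3) (x : E3) :
    pgv 2 (psiP P j) x = psiVec (fderiv ℝ (pgv 1 P) x) (curl (pgv 1 P) x) j := by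
  have hAom : ∀ i, fderiv ℝ (pgv 1 P) x (curl (pgv 1 P) x) i = pg 2 (AomP P i) x := by
    intro i
    rw [fderiv_pgv_apply, AomP, pg_sum]
    refine Finset.sum_congr rfl fun j _ => ?_
    rw [curl_pgv, pgv_apply, pg_mul]
  have hAtom : ∀ i, ⟪fderiv ℝ (pgv 1 P) x (EuclideanSpace.single i (1 : ℝ)), curl (pgv 1 P) x⟫ =
      pg 2 (AtomP P i) x := by
    intro i
    rw [PiLp.inner_apply, AtomP, pg_sum]
    refine Finset.sum_congr rfl fun j _ => ?_
    rw [RCLike.inner_apply, conj_trivial, fderiv_pgv_single, curl_pgv, pgv_apply, pg_mul, mul_comm]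
  have hω : ∀ i, curl (pgv 1 P) x i = pg 1 (curlP 1 P i) x := fun i => by rw [curl_pgv, pgv_apply]
  ext i
  rw [pgv_apply]
  fin_cases j <;> fin_cases i <;>
    simp [psiP, psiVec, FP, hAom, hAtom, hω, pg_add, pg_neg, pg_mul, Matrix.vecHead, Matrix.vecTail]

/-- `W = 2(v·∇)v` for the explicit field. -/
theorem pgv_WP_eq (x : E3) : pgv 2 (WP P) x = convect (pgv 1 P) (pgv 1 P) x + convect (pgv 1 P) (pgv 1 P) x := by
  ext i
  rw [pgv_apply, PiLp.add_apply, convect_apply, fderiv_pgv_apply, ← two_mul, WP,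
    show (2 : P3) * ∑ j, P j * dg 1 j (P i) = (2 : ℝ) • ∑ j, P j * dg 1 j (P i) by
      rw [MvPolynomial.smul_eq_C_mul, map_ofNat], pg_smul, pg_sum]
  congr 1
  refine Finset.sum_congr rfl fun j _ => ?_
  rw [pgv_apply, pg_mul]

/-- the coe of `G = ∑ⱼ ∂ⱼ Ψⱼ`. -/
theorem sum_lineDerivOp_psiP_apply (x : E3) :
    (∑ j, (∂_{EuclideanSpace.single j (1 : ℝ)} (pgvS 2 (psiP P j)) : 𝓢(E3, E3))) x = pgv 2 (GP P) x := by
  ext i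
  rw [sum_apply, pgv_apply, GP, pg_sum]
  rw [WithLp.ofLp_sum, Finset.sum_apply]
  refine Finset.sum_congr rfl fun j _ => ?_
  rw [SchwartzMap.lineDerivOp_apply_eq_fderiv, coe_pgvS 2 two_pos, fderiv_pgv_single]

/-- `⟪W, G⟫ = (WGP) e^{-4r²}` pointwise. -/
theorem inner_W_G_eq (x : E3) :
    ⟪pgv 2 (WP P) x, pgv 2 (GP P) x⟫ = pg 4 (WGP P) x := by
  rw [PiLp.inner_apply, WGP, pg_sum]
  refine Finset.sum_congr rfl fun i _ => ?_
  rw [RCLike.inner_apply, conj_trivial, pgv_apply, pgv_apply, pg_mul, mul_comm]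

/-- the complex divergence of `pgvS 2 Q`, componentwise. -/
theorem lineDerivOp_proj_complexify_pgvS (Q : Fin 3 → P3) (i : Fin 3) :
    (∂_{EuclideanSpace.single i (1 : ℝ)}
      (SchwartzMap.postcompCLM ((EuclideanSpace.proj i : EuclideanSpace ℂ (Fin 3) →L[ℂ] ℂ).restrictScalars ℝ)
        (SchwartzMap.postcompCLM (𝕜 := ℝ) FunctionSpaces.EuclideanSpace.complexify.toContinuousLinearMap
          (pgvS 2 Q))) : 𝓢(E3, ℂ)) = pgC 2 (dg 2 i (Q i)) := by
  ext x
  rw [SchwartzMap.lineDerivOp_apply_eq_fderiv, pgC_apply 2 two_pos]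
  have hc : (⇑(SchwartzMap.postcompCLM ((EuclideanSpace.proj i : EuclideanSpace ℂ (Fin 3) →L[ℂ] ℂ).restrictScalars ℝ)
      (SchwartzMap.postcompCLM (𝕜 := ℝ) FunctionSpaces.EuclideanSpace.complexify.toContinuousLinearMap
        (pgvS 2 Q))) : E3 → ℂ) = ⇑Complex.ofRealCLM ∘ pg 2 (Q i) := by
    funext y
    simp only [SchwartzMap.postcompCLM_apply, Function.comp_apply, ContinuousLinearMap.coe_restrictScalars',
      LinearIsometry.coe_toContinuousLinearMap, pgvS_apply 2 two_pos]
    show (FunctionSpaces.EuclideanSpace.complexify (pgv 2 Q y)) i = _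
    rw [FunctionSpaces.EuclideanSpace.complexify_apply, pgv_apply]
    rfl
  rw [hc]
  have h := (Complex.ofRealCLM.hasFDerivAt.comp x (hasFDerivAt_pg 2 (Q i) x).differentiableAt.hasFDerivAt)
  rw [h.fderiv, ContinuousLinearMap.comp_apply, fderiv_pg_apply]
  simp [PiLp.single_apply]

/-- The complex divergence `∑ᵢ ∂ᵢ (Qᵢ e^{-2r²})_ℂ` of `pgvS 2 Q` is `pgC 2 (∑ᵢ dg 2 i (Q i))`, in the shape required by the duality formula. -/
theorem rho_eq (Q : Fin 3 → P3) :
    pgC 2 (∑ i, dg 2 i (Q i)) = ∑ i, (∂_{EuclideanSpace.single i (1 : ℝ)}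
      (SchwartzMap.postcompCLM ((EuclideanSpace.proj i : EuclideanSpace ℂ (Fin 3) →L[ℂ] ℂ).restrictScalars ℝ)
        (SchwartzMap.postcompCLM (𝕜 := ℝ) FunctionSpaces.EuclideanSpace.complexify.toContinuousLinearMap
          (pgvS 2 Q))) : 𝓢(E3, ℂ)) := by
  ext x
  rw [sum_apply, pgC_apply 2 two_pos, pg_sum]
  push_cast
  refine Finset.sum_congr rfl fun i _ => ?_
  rw [lineDerivOp_proj_complexify_pgvS, pgC_apply 2 two_pos]

open FourierTransform Complex in
open scoped ComplexConjugate in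
/-- **The order-3 Euler derivative of an explicit polynomial-Gaussian field**, reduced to a local Gaussian
integral and a Fourier-side Riesz integral of its two explicit divergences. -/
theorem orderThree_formula :
    -∫ x, (⟪curl (eulerBilinear (pgv 1 P) (pgv 1 P)) x, fderiv ℝ (pgv 1 P) x (curl (pgv 1 P) x)⟫ +
        ⟪curl (pgv 1 P) x, fderiv ℝ (eulerBilinear (pgv 1 P) (pgv 1 P)) x (curl (pgv 1 P) x)⟫ +
          ⟪curl (pgv 1 P) x, fderiv ℝ (pgv 1 P) x (curl (eulerBilinear (pgv 1 P) (pgv 1 P)) x)⟫) =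
      -2⁻¹ * ((∫ x, pg 4 (WGP P) x) - ((2 * Real.pi) ^ 2)⁻¹ *
        RCLike.re (∫ ξ : E3, 𝓕 (⇑(pgC 2 (rhoWP P))) ξ * conj (𝓕 (⇑(pgC 2 (rhoGP P))) ξ) /
          ((‖ξ‖ ^ 2 : ℝ) : ℂ))) := by
  have hv : IsSchwartzField (pgv 1 P) := isSchwartzField_pgv 1 one_pos P
  rw [orderThree_eq_integral_inner hv (fun j => pgvS 2 (psiP P j))
    (fun j x => by rw [pgvS_apply 2 two_pos, pgv_psiP_eq])]
  set G : 𝓢(E3, E3) := ∑ j, (∂_{EuclideanSpace.single j (1 : ℝ)} (pgvS 2 (psiP P j)) : 𝓢(E3, E3))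
  rw [integral_inner_eulerBilinear_eq (pgvS 2 (WP P)) G (fun x => by rw [pgvS_apply 2 two_pos, pgv_WP_eq]),
    integral_inner_lerayProjFun_eq_sub (pgvS 2 (WP P)) G (pgC 2 (rhoWP P)) (pgC 2 (rhoGP P))
      (rho_eq (WP P)) ?_]
  · congr 2
    refine integral_congr_ae (Filter.Eventually.of_forall fun x => ?_)
    beta_reduce
    rw [pgvS_apply 2 two_pos, sum_lineDerivOp_psiP_apply, inner_W_G_eq]
  · -- `G = pgvS 2 (GP P)` as Schwartz maps, then the divergence
    have hG : G = pgvS 2 (GP P) := by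
      ext x
      exact congrArg (fun (w : E3) => w _) (sum_lineDerivOp_psiP_apply P x ▸ (coe_pgvS 2 two_pos (GP P) ▸ rfl))
    rw [hG]
    exact rho_eq (GP P)

end Generic
end Summit.NavierStokesRegularity.NavierStokesRegularity.Theorems.OddMorawetz
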